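import Mathlib
import Literature.Analysis.FluidPDE.DecayingSelfSimilarEulerProfile

/-!
# Crux `EulerZoomLiouville.PowerGaugeEulerLiouville` (stmt-NavierStokesRegularity-19832), THE ONE STATEMENT `stub_selfSimilarC2Needle`:
# STAGNATION KINEMATICS of a self-similar profile — the transport field `W = γy + U` has `‖DW‖ ≥ |γ|` everywhere
# (no degenerate stagnation), and at a VORTICAL stagnation point `DU·Ω = Ω`: stretching exactly `1` along `Ω̂` and some
# unit direction compressed at rate `≥ 1/2`

ROUND-40 (nsreg-p2 g33) §2′ (N1) and the SHARPNESS of the subcritical strain clocks (S3)/(S4) of plate t40d: the thresholds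
`s < 1` (stretching) and `k < 1/2` (compression) under which lingering vortical labels are timed out are attained exactly at vortical
stagnation points of `W`.  Inputs: `tr DW = 3γ + div U = 3γ` (incompressibility) and the vorticity profile equation
`DΩ·W − DU·Ω = −Ω` (`IsSelfSimilarEulerProfile.vorticity_eq_sub_form`) at `W = 0`.

WHAT THIS IS NOT: not NS, not E — kinematic facts for THE ONE STATEMENT; no stratum is closed here; 19832 is OPEN.
[folklore; ConstantinIgnatovaVicol2026Putative §3.4.1 (3.23)]
-/

noncomputable section

set_option linter.dupNamespace false

open Set Metric Function InnerProductSpace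
open scoped RealInnerProductSpace

namespace Summit.NavierStokesRegularity.NavierStokesRegularity.Theorems.PowerGaugeEulerLiouville.Stagnation

open Literature.Analysis Literature.Analysis.FluidPDE


variable {γ : ℝ} {U : (EuclideanSpace ℝ (Fin 3)) → (EuclideanSpace ℝ (Fin 3))} {P : (EuclideanSpace ℝ (Fin 3)) → ℝ}

/-! ### Trace against operator norm -/

/-- `|tr A| ≤ 3‖A‖` for an operator on `ℝ³` (trace = sum of three diagonal inner products over an orthonormal basis). [folklore] -/
theorem abs_trace_le_three_mul_opNorm (A : (EuclideanSpace ℝ (Fin 3)) →L[ℝ] (EuclideanSpace ℝ (Fin 3))) :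
    |LinearMap.trace ℝ (EuclideanSpace ℝ (Fin 3)) (A : (EuclideanSpace ℝ (Fin 3)) →ₗ[ℝ] (EuclideanSpace ℝ (Fin 3)))| ≤ 3 * ‖A‖ := by
  set b := EuclideanSpace.basisFun (Fin 3) ℝ with hb
  rw [(A : (EuclideanSpace ℝ (Fin 3)) →ₗ[ℝ] (EuclideanSpace ℝ (Fin 3))).trace_eq_sum_inner b]
  have hterm : ∀ i, |⟪b i, (A : (EuclideanSpace ℝ (Fin 3)) →ₗ[ℝ] (EuclideanSpace ℝ (Fin 3))) (b i)⟫| ≤ ‖A‖ := by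
    intro i
    have h1 : ‖b i‖ = 1 := b.orthonormal.1 i
    calc |⟪b i, (A : (EuclideanSpace ℝ (Fin 3)) →ₗ[ℝ] (EuclideanSpace ℝ (Fin 3))) (b i)⟫| ≤ ‖b i‖ * ‖(A : (EuclideanSpace ℝ (Fin 3)) →ₗ[ℝ] (EuclideanSpace ℝ (Fin 3))) (b i)‖ := abs_real_inner_le_norm _ _
      _ = ‖A (b i)‖ := by rw [h1, one_mul]; rfl
      _ ≤ ‖A‖ * ‖b i‖ := A.le_opNorm _
      _ = ‖A‖ := by rw [h1, mul_one]
  calc |∑ i, ⟪b i, (A : (EuclideanSpace ℝ (Fin 3)) →ₗ[ℝ] (EuclideanSpace ℝ (Fin 3))) (b i)⟫| ≤ ∑ i, |⟪b i, (A : (EuclideanSpace ℝ (Fin 3)) →ₗ[ℝ] (EuclideanSpace ℝ (Fin 3))) (b i)⟫| := Finset.abs_sum_le_sum_abs _ _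
    _ ≤ ∑ _i : Fin 3, ‖A‖ := Finset.sum_le_sum fun i _ => hterm i
    _ = 3 * ‖A‖ := by simp

/-! ### The derivative of the transport field -/

/-- `DW(z) = γ·I + DU(z)`. -/
theorem hasFDerivAt_selfSimilarTransport {z : (EuclideanSpace ℝ (Fin 3))} (hU : DifferentiableAt ℝ U z) :
    HasFDerivAt (selfSimilarTransport γ 0 U) (γ • ContinuousLinearMap.id ℝ (EuclideanSpace ℝ (Fin 3)) + fderiv ℝ U z) z := by
  have h1 : HasFDerivAt (fun y : (EuclideanSpace ℝ (Fin 3)) => γ • (id y - 0)) (γ • ContinuousLinearMap.id ℝ (EuclideanSpace ℝ (Fin 3))) z :=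
    ((hasFDerivAt_id z).sub_const (0 : (EuclideanSpace ℝ (Fin 3)))).const_smul γ
  have h := h1.add hU.hasFDerivAt
  refine h.congr_of_eventuallyEq (Filter.Eventually.of_forall fun y => ?_)
  simp [selfSimilarTransport_apply]

/-- `fderiv` form of `hasFDerivAt_selfSimilarTransport`: `DW(z) = γ·I + DU(z)`. -/
theorem fderiv_selfSimilarTransport {z : (EuclideanSpace ℝ (Fin 3))} (hU : DifferentiableAt ℝ U z) :
    fderiv ℝ (selfSimilarTransport γ 0 U) z = γ • ContinuousLinearMap.id ℝ (EuclideanSpace ℝ (Fin 3)) + fderiv ℝ U z :=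
  (hasFDerivAt_selfSimilarTransport hU).fderiv

/-- `tr DW(z) = 3γ` for a divergence-free `U`. -/
theorem trace_fderiv_selfSimilarTransport {z : (EuclideanSpace ℝ (Fin 3))} (hU : DifferentiableAt ℝ U z)
    (hdiv : VectorCalculus.divergence U z = 0) :
    LinearMap.trace ℝ (EuclideanSpace ℝ (Fin 3)) ((fderiv ℝ (selfSimilarTransport γ 0 U) z : (EuclideanSpace ℝ (Fin 3)) →L[ℝ] (EuclideanSpace ℝ (Fin 3))) : (EuclideanSpace ℝ (Fin 3)) →ₗ[ℝ] (EuclideanSpace ℝ (Fin 3))) = 3 * γ := by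
  rw [fderiv_selfSimilarTransport hU]
  have htrU : LinearMap.trace ℝ (EuclideanSpace ℝ (Fin 3)) ((fderiv ℝ U z : (EuclideanSpace ℝ (Fin 3)) →L[ℝ] (EuclideanSpace ℝ (Fin 3))) : (EuclideanSpace ℝ (Fin 3)) →ₗ[ℝ] (EuclideanSpace ℝ (Fin 3))) = 0 := hdiv
  rw [ContinuousLinearMap.toLinearMap_add, ContinuousLinearMap.toLinearMap_smul, map_add, map_smul, htrU, add_zero,
    ContinuousLinearMap.coe_id, LinearMap.trace_id, finrank_euclideanSpace_fin]
  simp [mul_comm]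

/-- **(N1) NO DEGENERATE STAGNATION: `‖DW(z)‖ ≥ |γ|` at every point** of a differentiable divergence-free profile. [folklore] -/
theorem abs_le_norm_fderiv_selfSimilarTransport {z : (EuclideanSpace ℝ (Fin 3))} (hU : DifferentiableAt ℝ U z)
    (hdiv : VectorCalculus.divergence U z = 0) :
    |γ| ≤ ‖fderiv ℝ (selfSimilarTransport γ 0 U) z‖ := by
  have h := abs_trace_le_three_mul_opNorm (fderiv ℝ (selfSimilarTransport γ 0 U) z)
  rw [trace_fderiv_selfSimilarTransport hU hdiv, abs_mul, abs_of_pos (by norm_num : (0 : ℝ) < 3)] at h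
  linarith

/-- (N1) for a self-similar Euler profile: `‖DW‖ ≥ |γ|` everywhere; in particular `DW(z) ≠ 0` when `γ ≠ 0`. -/
theorem abs_le_norm_fderiv_selfSimilarTransport_of_profile (hprof : IsSelfSimilarEulerProfile γ 0 U P) (z : (EuclideanSpace ℝ (Fin 3))) :
    |γ| ≤ ‖fderiv ℝ (selfSimilarTransport γ 0 U) z‖ :=
  abs_le_norm_fderiv_selfSimilarTransport
    ((hprof.contDiff_velocity.differentiable (by norm_num)).differentiableAt) (hprof.divFree z)

/-! ### Vortical stagnation points -/

/-- **At a stagnation point of `W`, `DU·Ω = Ω`** (the vorticity profile equation `DΩ·W − DU·Ω = −Ω` at `W = 0`).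
[cite: ConstantinIgnatovaVicol2026Putative, §3.4.1 eq. (3.23)] -/
theorem fderiv_apply_curl_of_stagnation (hprof : IsSelfSimilarEulerProfile γ 0 U P) {z : (EuclideanSpace ℝ (Fin 3))}
    (hz : selfSimilarTransport γ 0 U z = 0) : fderiv ℝ U z (curl U z) = curl U z := by
  have h := hprof.vorticity_eq_sub_form z
  rw [selfSimilarTransport_apply] at hz
  rw [hz, map_zero, zero_sub, neg_inj] at h
  exact h

/-- `DW·Ω = (1+γ)Ω` at a stagnation point. -/
theorem fderiv_transport_apply_curl_of_stagnation (hprof : IsSelfSimilarEulerProfile γ 0 U P) {z : (EuclideanSpace ℝ (Fin 3))}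
    (hz : selfSimilarTransport γ 0 U z = 0) :
    fderiv ℝ (selfSimilarTransport γ 0 U) z (curl U z) = (1 + γ) • curl U z := by
  rw [fderiv_selfSimilarTransport ((hprof.contDiff_velocity.differentiable (by norm_num)).differentiableAt),
    _root_.add_apply, _root_.smul_apply, ContinuousLinearMap.id_apply,
    fderiv_apply_curl_of_stagnation hprof hz, add_smul, one_smul, add_comm]

/-- **STRETCHING EXACTLY `1` ALONG `Ω̂` at a vortical stagnation point**: `⟪DU(z)Ω̂, Ω̂⟫ = 1` — the threshold `s < 1` of the stretching clock
(t40d (S3)) is sharp exactly here. [folklore] -/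
theorem inner_fderiv_unitCurl_of_stagnation (hprof : IsSelfSimilarEulerProfile γ 0 U P) {z : (EuclideanSpace ℝ (Fin 3))}
    (hz : selfSimilarTransport γ 0 U z = 0) (hΩ : curl U z ≠ 0) :
    ⟪fderiv ℝ U z (‖curl U z‖⁻¹ • curl U z), ‖curl U z‖⁻¹ • curl U z⟫ = 1 := by
  have hn : ‖curl U z‖ ≠ 0 := norm_ne_zero_iff.2 hΩ
  rw [map_smul, fderiv_apply_curl_of_stagnation hprof hz, real_inner_smul_left, real_inner_smul_right,
    real_inner_self_eq_norm_sq]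
  field_simp

/-- **SOME UNIT DIRECTION IS COMPRESSED AT RATE `≥ 1/2` at a vortical stagnation point**: `tr DU = 0` and `⟪DU Ω̂, Ω̂⟫ = 1` force, in any
orthonormal frame `(Ω̂, b₁, b₂)`, `⟪DU b₁, b₁⟫ + ⟪DU b₂, b₂⟫ = −1` — the threshold `k < 1/2` of the compression clock (t40d (S4)) is sharp exactly here.
[folklore] -/
theorem exists_inner_fderiv_le_neg_half_of_stagnation (hprof : IsSelfSimilarEulerProfile γ 0 U P) {z : (EuclideanSpace ℝ (Fin 3))}
    (hz : selfSimilarTransport γ 0 U z = 0) (hΩ : curl U z ≠ 0) :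
    ∃ v : (EuclideanSpace ℝ (Fin 3)), ‖v‖ = 1 ∧ ⟪fderiv ℝ U z v, v⟫ ≤ -(1 / 2) := by
  set e : (EuclideanSpace ℝ (Fin 3)) := ‖curl U z‖⁻¹ • curl U z with he
  have hn : ‖curl U z‖ ≠ 0 := norm_ne_zero_iff.2 hΩ
  have he1 : ‖e‖ = 1 := by rw [he, norm_smul, norm_inv, norm_norm, inv_mul_cancel₀ hn]
  -- an orthonormal basis through `e`
  set v : Fin 3 → (EuclideanSpace ℝ (Fin 3)) := fun _ => e with hv
  have hon : Orthonormal ℝ (({0} : Set (Fin 3)).restrict v) := by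
    refine ⟨fun i => by simp [hv, he1], fun i j hij => ?_⟩
    exact absurd (Subsingleton.elim i j) hij
  obtain ⟨b, hb⟩ := Orthonormal.exists_orthonormalBasis_extension_of_card_eq (𝕜 := ℝ) (E := (EuclideanSpace ℝ (Fin 3)))
    (by rw [finrank_euclideanSpace_fin, Fintype.card_fin]) hon
  have hb0 : b 0 = e := hb 0 rfl
  -- the trace identity in the frame `b`
  set A : (EuclideanSpace ℝ (Fin 3)) →L[ℝ] (EuclideanSpace ℝ (Fin 3)) := fderiv ℝ U z with hA
  have htr : LinearMap.trace ℝ (EuclideanSpace ℝ (Fin 3)) (A : (EuclideanSpace ℝ (Fin 3)) →ₗ[ℝ] (EuclideanSpace ℝ (Fin 3))) = 0 := hprof.divFree z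
  rw [(A : (EuclideanSpace ℝ (Fin 3)) →ₗ[ℝ] (EuclideanSpace ℝ (Fin 3))).trace_eq_sum_inner b, Fin.sum_univ_three, hb0] at htr
  simp only [ContinuousLinearMap.coe_coe] at htr
  have h0 : ⟪e, A e⟫ = 1 := by
    rw [real_inner_comm]
    exact inner_fderiv_unitCurl_of_stagnation hprof hz hΩ
  rw [h0] at htr
  have hc1 : ⟪A (b 1), b 1⟫ = ⟪b 1, A (b 1)⟫ := real_inner_comm _ _
  have hc2 : ⟪A (b 2), b 2⟫ = ⟪b 2, A (b 2)⟫ := real_inner_comm _ _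
  by_cases h1 : ⟪b 1, A (b 1)⟫ ≤ -(1 / 2)
  · exact ⟨b 1, b.orthonormal.1 1, by rw [hc1]; exact h1⟩
  · refine ⟨b 2, b.orthonormal.1 2, ?_⟩
    rw [hc2]
    linarith [not_le.1 h1]

end Summit.NavierStokesRegularity.NavierStokesRegularity.Theorems.PowerGaugeEulerLiouville.Stagnation
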